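import Summits.QuantumFields.YangMills.Theorems.BalabanUVNodesN12GaugeLetterLocAtRecord
import Literature.MathematicalPhysics.QuantumFieldTheory.Balaban1983to89.Node00.TorusCoverGaugeTokensR
import Literature.MathematicalPhysics.QuantumFieldTheory.Balaban1983to89.Node00.TkFirstStepRegionVanishing
import HarnessLib

/-!
# BalabanUVNodes ∕ N12 — THE PLAQUETTE LETTER OF THE (σ)_N CAPSTONE IS THE MINIMISER's CLASS: the level-form boxes around the sources of the bonds of `Ω₁(Z)` lie in the support
# `Ω₀ = hullD M₁ 1 Ω₁` of [III] (2.13) (the printed collar `dist(Ω_J, Ω_{J−1}ᶜ) ≥ L^J M₁` for `J ≥ 2`, the support layer for `J = 1`), where [15] (2) ∕ [6] (1.7) at scale `0` makes every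
# plaquette of `U₀` `εreg`-small — so (σ)_N at the record holds modulo the region datum, the `N`-geometry, the plaquette letter on the iterated averages, the datum letter and NUMERICS only

Cell `pub-ymgap` (HUMAN RULINGS D-0062 ∕ D-0149), WIDTH SEAT `pub-ymgap-dag-n12-w3` g4 (node N12 = [B15]; key K1⁹ `stmt-QuantumFields-27364` (KEY MAP v2), `--kind proof --supports … --as
helper`; count-neutral).  THEOREMS ONLY (0 `def`, 0 `instance`, 0 `sorry`); consumed BY NAME: this lineage's `N12GaugeLetterLocAtRecord.exists_gaugeLetterLoc_atRecord` (the capstone),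
r11∕r12's `B14.Eq213DetSet.dist_maxDomT` (the printed collar on the cover), NODE 00's `Node00.cover_mem_hullD_one_of_within` ∕ `Node00.subset_hullD_self` (the support hull), the class of record
`Node00.regMSCoPOfRecord` = [15] (2) on the support `Node00.suppDomOfRecord = hullD M₁ 1 Ω₁`.

WHY.  The capstone `exists_gaugeLetterLoc_atRecord` displays ONE graded root-free plaquette letter for the minimiser: `PlaqSmallOn S εP U₀` together with «the coordinate box of radius
`R_{J,J′} = 2·max ℓ_J ℓ_{J′} + 1 + m·L^{min(J+1,k)} + ℓ_J` (+2) around `b₋` lies in `S`» for every bond `b` inside `Ω₁(Z)` with end levels `J, J′`.  The class of the (2.12) minimiser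
([15] (2) ∕ [6] (1.7) at scale `0`, `hmin.1`) gives `PlaqSmallOn (plaqsOf Ω₀) (εreg·η₀²) U₀` on the SUPPORT `Ω₀ = suppDomOfRecord = hullD M₁ 1 Ω₁`.  GEOMETRY (§1): every plaquette of the box has
its source within sup-distance `R + 2` of `b₋ ∈ Ω_J`; for `J ≥ 2` the printed collar puts it in `Ω_{J−1} ⊆ Ω₁ ⊆ Ω₀` as soon as `R + 3 ≤ L^J M₁`, for `J = 1` the support layer does as soon as
`R + 2 ≤ M₁`; `|J − J′| ≤ 1` (`N12BjRootChainsGraded.exists_chain_centre_centre_graded`) bounds `R_{J,J′} ≤ R(J) := 2ℓ_{J+1} + 1 + m·L^{min(J+1,k)} + ℓ_J`.  Hence (§2) ★★★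
`exists_gaugeLetterLoc_atRecord_of_class`: the capstone's conclusion with `S := plaqsOf Ω₀`, `εP := εreg·η₀²`, under the ONE numeric hypothesis `R(J) + 3 ≤ L^{J−1}·M₁` (`1 ≤ J ≤ k`;
⟸ `M₁ ≥ C(d,L)·L²`, the knit's numerics) — no plaquette letter for `U₀` displayed any more.
SCALING (honest; lane word dag-n12-c g20 2026-08-28 «keep both editions»): `η₀ = eta 0 = 1`, so `εP = εreg` is the COARSEST (scale-0) class tolerance and the Stokes term
`((2ℓ_k+1+m·L^k)²∕4)·εreg` is crude twice (cap radius² of the uniform first-layer tolerance, scale-0 smallness): it sits below a chart threshold `δ₀` only if `εreg ≲ δ₀·L^{−2k}`.  Print's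
scaling (radius `∼ L^{J+1}` against the level-`(J−1)` class `εreg·η_{J−1}²`, i.e. `∼ L⁴·εreg` per bond) needs a PER-BOND tolerance in the first-layer producer; §1 already certifies the
per-level membership (box ⊆ `Ω_{J−1}` for `J ≥ 2`) such a producer would consume.  The graded-letter edition `N12GaugeLetterLocAtRecord.exists_gaugeLetterLoc_atRecord` stays the general socket.

HONEST FRAMING.  Composition by name + lattice bookkeeping; the minimiser ([15] Thm 1 ∕ (E)), the region datum, the `N`-geometry, the plaquette letter on the iterated averages ([Balaban1985Averaging]
Prop. 1–2, local), the datum letter and the numerics stay HYPOTHESES; nothing of Bałaban's asserted; count-neutral; N12 NOT discharged; K1⁹ NOT closed; counts unmoved (typed 28∕28 · discharged 5∕27);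
one finite 𝕋⁴ programme at fixed ε — R4 closes the conditional rung `BalabanLadder.UV` only; the Yang–Mills mass gap (Clay) is NOT proved by any of this; nothing continuum ∕ ℝ⁴ ∕ OS.
-/

noncomputable section

open scoped Matrix.Norms.L2Operator BigOperators

namespace Summit.QuantumFields.YangMills.BalabanUVNodes.N12GaugeLetterLocOfClass

open Literature.MathematicalPhysics.QuantumFieldTheory.Balaban1983to89
open T4Continuum GaugeField B15DeterminingSets BlockAveraging
open T4CubeChartGnomonic (SU2)
open B16Sect1Backgrounds (toMS)
open T4AxialGaugeSmallField (boxPlaqs castSite)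
open B14.Eq213MaximalDomains (side)
open B14.Eq213DetSet (Bj maxDomT maxDomT_antitone dist_maxDomT)
open B14.Eq216Concrete (inputs)
open B14.Eq22Determines (blockIter)
open B14DomainGeom (Within)
open B15Eq112TorusCover (cover lift cover_lift cover_apply)
open B5Eq118OneStroke (iterBlockOf)
open B7Prop1Explicit (e e_apply)
open B8Eq17ClassAkV1 (plaqsOf)
open ExpMeanLog (deltaSU)
open Literature.MathematicalPhysics.QuantumFieldTheory.BalabanImbrieJaffe1984to88.BIJ85Eq453GaugeField (qsstarGIter0)
open Summit.QuantumFields.YangMills.BalabanUVNodes.N12BjCollarRoots (le_of_iterBlockOf_mem_Bj mem_maxDomT_of_iterBlockOf_mem_Bj)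
open Summit.QuantumFields.YangMills.BalabanUVNodes.N12BjRootChainsGraded (exists_chain_centre_centre_graded)
open Summit.QuantumFields.YangMills.BalabanUVNodes.N12GaugeLetterLocAtRecord (exists_gaugeLetterLoc_atRecord)

variable {P : Params}

/-! ## §1 The level-form boxes lie in the support -/

section Geometry

/-- The source of a plaquette of the coordinate box of radius `R` (+2) around `x` is the projection of an integer point within sup-distance `R + 2` of the standard lift of `x`. [folklore] -/
theorem exists_cover_of_mem_boxPlaqs (x : Site P 0) (R : ℕ) {p : Plaq P 0}
    (hp : p ∈ (boxPlaqs (fun κ => ((x κ).val : ℤ) - (R : ℤ)) (fun κ => ((x κ).val : ℤ) + (R : ℤ) + 2) : Set (Plaq P 0))) :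
    ∃ z : Fin P.d → ℤ, p.src = cover P z ∧ Within ((R : ℤ) + 2) (lift P x) z := by
  obtain ⟨z, hlo, hhi, hsrc⟩ := hp
  refine ⟨z, hsrc, fun κ => ?_⟩
  have h1 := hlo κ
  have h2 := hhi κ
  simp only [Pi.add_apply, e_apply] at h2
  have he1 : (0 : ℤ) ≤ (if κ = p.μ then 1 else 0) := by split_ifs <;> norm_num
  have he2 : (0 : ℤ) ≤ (if κ = p.ν then 1 else 0) := by split_ifs <;> norm_num
  rw [abs_le]
  simp only [lift]
  constructor <;> linarith

/-- ★★ **THE GRADED BOXES LIE IN THE SUPPORT.**  `M₁ ≥ 1`, cover divisibility at level `k`, `1 ≤ J ≤ k`, `x ∈ Ω_J`, radius `R` with `R + 3 ≤ L^{J−1}·M₁`: every plaquette of the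
coordinate box of radius `R` (+2) around `x` has its source in the support hull `hullD M₁ 1 Ω₁` of [III] (2.13) — for `J ≥ 2` by the printed collar (`dist_maxDomT`: within `L^J M₁ − 1` of a point
of `Ω_J` lies `Ω_{J−1} ⊆ Ω₁ ⊆ hullD M₁ 1 Ω₁`), for `J = 1` by the one layer of `M₁`-cubes of the support (`Node00.cover_mem_hullD_one_of_within`).
[cite: Balaban1988Convergent, p.255 («support»), (2.13) pp.256–257; Balaban1985Variational, (2) p.278] -/
theorem boxPlaqs_src_mem_hullD {M₁ k : ℕ} {Z : Set (Site P 0)} (hM : 1 ≤ M₁) (hdiv : side P.L M₁ k ∣ P.sitesPerDir 0)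
    {J : ℕ} (hJ1 : 1 ≤ J) (hJk : J ≤ k) {x : Site P 0} (hx : x ∈ maxDomT M₁ Z J) {R : ℕ} (hR : R + 3 ≤ P.L ^ (J - 1) * M₁)
    {p : Plaq P 0} (hp : p ∈ (boxPlaqs (fun κ => ((x κ).val : ℤ) - (R : ℤ)) (fun κ => ((x κ).val : ℤ) + (R : ℤ) + 2) : Set (Plaq P 0))) :
    p.src ∈ Node00.hullD P M₁ 1 (maxDomT M₁ Z 1) := by
  obtain ⟨z, hsrc, hw⟩ := exists_cover_of_mem_boxPlaqs x R hp
  rw [hsrc]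
  rcases Nat.lt_or_ge 1 J with h2 | h1
  · -- `J ≥ 2`: the printed collar
    obtain ⟨n, rfl⟩ : ∃ n, J = n + 1 := ⟨J - 1, by omega⟩
    rw [Nat.add_sub_cancel] at hR
    have hmono : P.L ^ n * M₁ ≤ P.L ^ (n + 1) * M₁ := Nat.mul_le_mul_right _ (Nat.pow_le_pow_right P.L_pos (Nat.le_succ n))
    have hside : (R : ℤ) + 2 ≤ ((side P.L M₁ (n + 1) : ℕ) : ℤ) - 1 := by
      unfold side
      have : R + 3 ≤ P.L ^ (n + 1) * M₁ := hR.trans hmono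
      omega
    have hmem : cover P z ∈ maxDomT M₁ Z n :=
      dist_maxDomT hM hdiv (show n + 1 ≤ k from hJk) (x := lift P x) (by rw [cover_lift]; exact hx) (fun i => (hw i).trans hside)
    have hn1 : 1 ≤ n := by omega
    exact Node00.subset_hullD_self P M₁ (by omega) 1 _ (maxDomT_antitone hM Z hn1 hmem)
  · -- `J = 1`: the support layer
    have hJ : J = 1 := le_antisymm h1 hJ1
    subst hJ
    rw [Nat.sub_self, pow_zero, one_mul] at hR
    refine Node00.cover_mem_hullD_one_of_within (by omega) (y := lift P x) (by rw [cover_lift]; exact hx) fun i => ?_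
    rw [abs_sub_comm]
    exact (hw i).trans (by omega)

end Geometry

/-! ## §2 (σ)_N at the record with the plaquette letter of `U₀` read off the class -/

section Record

/-- ★★★ **(σ)_N AT THE RECORD, THE PLAQUETTE LETTER OF `U₀` BEING THE CLASS.**  As `N12GaugeLetterLocAtRecord.exists_gaugeLetterLoc_atRecord`, but the graded root-free plaquette letter is
DISCHARGED: `S := plaqsOf Ω₀` (plaquettes with a corner in the support `Ω₀ = suppDomOfRecord = hullD M₁ 1 Ω₁`), `εP := εreg·η₀²`, `PlaqSmallOn S εP U₀` from the minimiser's class ([15] (2) at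
scale `0`, `hmin.1`), the boxes inside `Ω₀` by §1 under ONE numeric hypothesis `R(J) + 3 ≤ L^{J−1}·M₁` for `1 ≤ J ≤ k`, `R(J) := 2ℓ_{J+1} + 1 + m·L^{min(J+1,k)} + ℓ_J` (`0 ≤ εreg`).  DISPLAYED: the
minimiser in NODE 00's class, the region datum `W 𝒞 ρn`, the `N`-geometry, the plaquette letter `a_j`∕`θ` on the iterated averages near member segments, the datum letter `hWj`, no wrapping, the
radius numerics.  Conclusion: the (σ)_N letter of record with tolerance `max ρn (((2ℓ_k+1+m·L^k)²∕4)·(εreg·η₀²) + m·θ_k + m·δ₁)`.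
[cite: Balaban1985Variational, (2)–(4) p.278, Thm 1 (8) p.279, (16)–(18) p.280; Balaban1985RegularSpaces, (1.7) p.77, (1.19) p.79; Balaban1988Convergent, p.255, (2.12)–(2.13) pp.256–257; Balaban1987RG1, (0.4) p.253] -/
theorem exists_gaugeLetterLoc_atRecord_of_class {F : T4Family} (ν : Node00.Stage7Numerics) (Kt : ℕ) {k : ℕ} (hk0 : 0 < k) (hk : k ≤ (F.P Kt).m + (F.P Kt).K)
    (hM2 : 2 ≤ ν.M₁) (hdiv : side (F.P Kt).L ν.M₁ k ∣ (F.P Kt).sitesPerDir 0) (Z : Set (Site (F.P Kt) 0)) (hεreg : 0 ≤ ν.εreg)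
    -- no wrapping, at the caps `ℓ_k`, `m·L^k`
    (hN : 2 * (∑ i ∈ Finset.range (k + 1), ((F.P Kt).d * (((F.P Kt).L ^ i - 1) / 2) + 1)) + 1 +
      (3 * ((F.P Kt).d * (((F.P Kt).L - 1) / 2)) + 5) * (F.P Kt).L ^ k < (F.P Kt).sitesPerDir 0)
    -- radius numerics: the level-`J` box fits the collar `L^{J−1}·M₁`
    (hRad : ∀ J, 1 ≤ J → J ≤ k →
      (2 * ∑ i ∈ Finset.range (J + 1 + 1), ((F.P Kt).d * (((F.P Kt).L ^ i - 1) / 2) + 1)) + 1 +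
          (3 * ((F.P Kt).d * (((F.P Kt).L - 1) / 2)) + 5) * (F.P Kt).L ^ min (J + 1) k +
        (∑ i ∈ Finset.range (J + 1), ((F.P Kt).d * (((F.P Kt).L ^ i - 1) / 2) + 1)) + 3 ≤ (F.P Kt).L ^ (J - 1) * ν.M₁)
    -- the region-normalised datum and the minimiser
    {ρn : ℝ} (hρn : 0 ≤ ρn)
    (W : GaugeField (F.P Kt) k SU2) (𝒞 : Set (PBond (F.P Kt) k)) (hD : ∀ c ∈ 𝒞, dist1 (W c) ≤ ρn)
    {U₀ : GaugeField (F.P Kt) 0 SU2}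
    (hmin : IsMinimizer (Node00.avOfRecord F 2 Kt) (Node00.regMSCoPOfRecord F 2 ν Kt k (maxDomT ν.M₁ Z)) (Bj ν.M₁ Z k)
      (avgFamily (Node00.avOfRecord F 2 Kt) (qsstarGIter0 k W)) U₀)
    -- geometry of the neighbourhood (dag-n12-w6's letters, verbatim)
    (N : Set (PBond (F.P Kt) 0))
    (hGN : ∀ b ∈ N, (b.src ∉ maxDomT ν.M₁ Z 1 ∨ b.tgt ∉ maxDomT ν.M₁ Z 1) → blockIter k b.tgt ≠ blockIter k b.src →
      (⟨blockIter k b.src, b.dir⟩ : PBond (F.P Kt) k) ∈ 𝒞)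
    (hN1 : ∀ p : Plaq (F.P Kt) 0, ((⟨p.src, p.μ⟩ : PBond (F.P Kt) 0) ∈ {b : PBond (F.P Kt) 0 | b.src ∈ maxDomT ν.M₁ Z 1} ∨
        (⟨p.src.shift p.μ, p.ν⟩ : PBond (F.P Kt) 0) ∈ {b : PBond (F.P Kt) 0 | b.src ∈ maxDomT ν.M₁ Z 1} ∨
        (⟨p.src.shift p.ν, p.μ⟩ : PBond (F.P Kt) 0) ∈ {b : PBond (F.P Kt) 0 | b.src ∈ maxDomT ν.M₁ Z 1} ∨
        (⟨p.src, p.ν⟩ : PBond (F.P Kt) 0) ∈ {b : PBond (F.P Kt) 0 | b.src ∈ maxDomT ν.M₁ Z 1}) →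
      (⟨p.src, p.μ⟩ : PBond (F.P Kt) 0) ∈ N ∧ (⟨p.src.shift p.μ, p.ν⟩ : PBond (F.P Kt) 0) ∈ N ∧
        (⟨p.src.shift p.ν, p.μ⟩ : PBond (F.P Kt) 0) ∈ N ∧ (⟨p.src, p.ν⟩ : PBond (F.P Kt) 0) ∈ N)
    -- DISPLAYED: the plaquette letter on the iterated averages near the member segments, with its budgets
    (a θ : ℕ → ℝ) (hθ0 : 0 ≤ θ 0) (ha0 : ∀ j, 0 ≤ a j)
    (haN : ∀ j < k, (((((F.P Kt).d + 2) * (F.P Kt).L : ℕ) : ℝ) ^ 2 / 4) * a j < deltaSU (Fin 2))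
    (hθ : ∀ j, 6 * ((((((F.P Kt).d + 2) * (F.P Kt).L : ℕ) : ℝ) ^ 2 / 4) * a j) + (F.P Kt).L * θ j ≤ θ (j + 1))
    (ha : ∀ i ≤ k, ∀ c ∈ bondsOf ((Bj ν.M₁ Z k : DetSet (F.P Kt)) i), ∀ j < i, ∀ c' : PBond (F.P Kt) (j + 1), c'.dir = c.dir →
      (∃ s < (F.P Kt).L ^ i, embIter (j + 1) c'.src = (fun z : Site (F.P Kt) 0 => z.shift c.dir)^[s] (embIter i c.src)) →
      ∀ q : Plaq (F.P Kt) j, (blockOf q.src = c'.src.unshift c'.dir ∨ blockOf q.src = c'.src ∨ blockOf q.src = c'.tgt) →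
        dist1 (GaugeField.plaqHol (avgFamily (Node00.avOfRecord F 2 Kt) U₀ j) q) < a j)
    -- DISPLAYED: the datum letter at the members (levels `≤ k`)
    {δ₁ : ℝ} (hδ0 : 0 ≤ δ₁) (hWj : ∀ i ≤ k, ∀ c ∈ bondsOf ((Bj ν.M₁ Z k : DetSet (F.P Kt)) i), dist1 (avgFamily (Node00.avOfRecord F 2 Kt) (qsstarGIter0 k W) i c) ≤ δ₁) :
    ∃ σ : GaugeTransf (F.P Kt) 0 SU2,
      (∀ j, j ≤ k → ∀ b ∈ bondsOf (Bj ν.M₁ Z k j), toMS σ j b.src = 1 ∧ toMS σ j b.tgt = 1) ∧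
        (∀ p : Plaq (F.P Kt) 0, ((⟨p.src, p.μ⟩ : PBond (F.P Kt) 0) ∈ {b : PBond (F.P Kt) 0 | b.src ∈ maxDomT ν.M₁ Z 1} ∨
            (⟨p.src.shift p.μ, p.ν⟩ : PBond (F.P Kt) 0) ∈ {b : PBond (F.P Kt) 0 | b.src ∈ maxDomT ν.M₁ Z 1} ∨
            (⟨p.src.shift p.ν, p.μ⟩ : PBond (F.P Kt) 0) ∈ {b : PBond (F.P Kt) 0 | b.src ∈ maxDomT ν.M₁ Z 1} ∨
            (⟨p.src, p.ν⟩ : PBond (F.P Kt) 0) ∈ {b : PBond (F.P Kt) 0 | b.src ∈ maxDomT ν.M₁ Z 1}) →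
          ‖((gaugeAct σ U₀ ⟨p.src, p.μ⟩ : SU2) : Matrix (Fin 2) (Fin 2) ℂ) - 1‖ ≤
              max ρn ((((2 * (∑ i ∈ Finset.range (k + 1), ((F.P Kt).d * (((F.P Kt).L ^ i - 1) / 2) + 1)) + 1 +
                  (3 * ((F.P Kt).d * (((F.P Kt).L - 1) / 2)) + 5) * (F.P Kt).L ^ k : ℕ) : ℝ)) ^ 2 / 4 * (ν.εreg * (F.P Kt).eta 0 ^ 2) +
                ((3 * ((F.P Kt).d * (((F.P Kt).L - 1) / 2)) + 5 : ℕ) : ℝ) * θ k + ((3 * ((F.P Kt).d * (((F.P Kt).L - 1) / 2)) + 5 : ℕ) : ℝ) * δ₁) ∧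
            ‖((gaugeAct σ U₀ ⟨p.src.shift p.μ, p.ν⟩ : SU2) : Matrix (Fin 2) (Fin 2) ℂ) - 1‖ ≤
              max ρn ((((2 * (∑ i ∈ Finset.range (k + 1), ((F.P Kt).d * (((F.P Kt).L ^ i - 1) / 2) + 1)) + 1 +
                  (3 * ((F.P Kt).d * (((F.P Kt).L - 1) / 2)) + 5) * (F.P Kt).L ^ k : ℕ) : ℝ)) ^ 2 / 4 * (ν.εreg * (F.P Kt).eta 0 ^ 2) +
                ((3 * ((F.P Kt).d * (((F.P Kt).L - 1) / 2)) + 5 : ℕ) : ℝ) * θ k + ((3 * ((F.P Kt).d * (((F.P Kt).L - 1) / 2)) + 5 : ℕ) : ℝ) * δ₁) ∧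
            ‖((gaugeAct σ U₀ ⟨p.src.shift p.ν, p.μ⟩ : SU2) : Matrix (Fin 2) (Fin 2) ℂ) - 1‖ ≤
              max ρn ((((2 * (∑ i ∈ Finset.range (k + 1), ((F.P Kt).d * (((F.P Kt).L ^ i - 1) / 2) + 1)) + 1 +
                  (3 * ((F.P Kt).d * (((F.P Kt).L - 1) / 2)) + 5) * (F.P Kt).L ^ k : ℕ) : ℝ)) ^ 2 / 4 * (ν.εreg * (F.P Kt).eta 0 ^ 2) +
                ((3 * ((F.P Kt).d * (((F.P Kt).L - 1) / 2)) + 5 : ℕ) : ℝ) * θ k + ((3 * ((F.P Kt).d * (((F.P Kt).L - 1) / 2)) + 5 : ℕ) : ℝ) * δ₁) ∧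
            ‖((gaugeAct σ U₀ ⟨p.src, p.ν⟩ : SU2) : Matrix (Fin 2) (Fin 2) ℂ) - 1‖ ≤
              max ρn ((((2 * (∑ i ∈ Finset.range (k + 1), ((F.P Kt).d * (((F.P Kt).L ^ i - 1) / 2) + 1)) + 1 +
                  (3 * ((F.P Kt).d * (((F.P Kt).L - 1) / 2)) + 5) * (F.P Kt).L ^ k : ℕ) : ℝ)) ^ 2 / 4 * (ν.εreg * (F.P Kt).eta 0 ^ 2) +
                ((3 * ((F.P Kt).d * (((F.P Kt).L - 1) / 2)) + 5 : ℕ) : ℝ) * θ k + ((3 * ((F.P Kt).d * (((F.P Kt).L - 1) / 2)) + 5 : ℕ) : ℝ) * δ₁)) ∧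
        (∀ b ∈ inputs (Bj ν.M₁ Z k), b ∈ N →
          ‖((gaugeAct σ U₀ b : SU2) : Matrix (Fin 2) (Fin 2) ℂ) - 1‖ ≤
              max ρn ((((2 * (∑ i ∈ Finset.range (k + 1), ((F.P Kt).d * (((F.P Kt).L ^ i - 1) / 2) + 1)) + 1 +
                  (3 * ((F.P Kt).d * (((F.P Kt).L - 1) / 2)) + 5) * (F.P Kt).L ^ k : ℕ) : ℝ)) ^ 2 / 4 * (ν.εreg * (F.P Kt).eta 0 ^ 2) +
                ((3 * ((F.P Kt).d * (((F.P Kt).L - 1) / 2)) + 5 : ℕ) : ℝ) * θ k + ((3 * ((F.P Kt).d * (((F.P Kt).L - 1) / 2)) + 5 : ℕ) : ℝ) * δ₁)) := by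
  have hM : 1 ≤ ν.M₁ := by omega
  have hk1 : 1 ≤ k := hk0
  -- the class at scale `0`: every plaquette of the support is `εreg·η₀²`-small
  have hclass := (Node00.mem_regMSCoPOfRecordAt_iff F 2 ν Kt k (Node00.suppDomOfRecord F ν Kt (maxDomT ν.M₁ Z)) (maxDomT ν.M₁ Z) U₀).1 hmin.1
  have hP : PlaqSmallOn (plaqsOf (Node00.suppDomOfRecord F ν Kt (maxDomT ν.M₁ Z))) (ν.εreg * (F.P Kt).eta 0 ^ 2) U₀ := by
    have h := hclass.1 0 (Nat.zero_le k)
    rwa [Node00.topSeq_zero] at h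
  have hεP : 0 ≤ ν.εreg * (F.P Kt).eta 0 ^ 2 := mul_nonneg hεreg (pow_nonneg (by unfold Params.eta; positivity) 2)
  -- the sums `ℓ_J` grow with `J`
  have hℓmono : ∀ {a b : ℕ}, a ≤ b → ∑ i ∈ Finset.range (a + 1), ((F.P Kt).d * (((F.P Kt).L ^ i - 1) / 2) + 1) ≤
      ∑ i ∈ Finset.range (b + 1), ((F.P Kt).d * (((F.P Kt).L ^ i - 1) / 2) + 1) := fun {a b} hab => by
    apply Finset.sum_le_sum_of_subset
    intro i hi
    simp only [Finset.mem_range] at hi ⊢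
    omega
  -- the graded boxes lie in the support
  have hSΩ : ∀ b : PBond (F.P Kt) 0, b.src ∈ maxDomT ν.M₁ Z 1 → b.tgt ∈ maxDomT ν.M₁ Z 1 →
      ∀ J J' : ℕ, iterBlockOf J b.src ∈ (Bj ν.M₁ Z k : DetSet (F.P Kt)) J → iterBlockOf J' b.tgt ∈ (Bj ν.M₁ Z k : DetSet (F.P Kt)) J' →
      (boxPlaqs
          (fun κ => ((b.src κ).val : ℤ) -
            (((2 * max (∑ i ∈ Finset.range (J + 1), ((F.P Kt).d * (((F.P Kt).L ^ i - 1) / 2) + 1))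
                  (∑ i ∈ Finset.range (J' + 1), ((F.P Kt).d * (((F.P Kt).L ^ i - 1) / 2) + 1)) + 1 +
                (3 * ((F.P Kt).d * (((F.P Kt).L - 1) / 2)) + 5) * (F.P Kt).L ^ min (J + 1) k) +
              ∑ i ∈ Finset.range (J + 1), ((F.P Kt).d * (((F.P Kt).L ^ i - 1) / 2) + 1) : ℕ) : ℤ))
          (fun κ => ((b.src κ).val : ℤ) +
            (((2 * max (∑ i ∈ Finset.range (J + 1), ((F.P Kt).d * (((F.P Kt).L ^ i - 1) / 2) + 1))
                  (∑ i ∈ Finset.range (J' + 1), ((F.P Kt).d * (((F.P Kt).L ^ i - 1) / 2) + 1)) + 1 +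
                (3 * ((F.P Kt).d * (((F.P Kt).L - 1) / 2)) + 5) * (F.P Kt).L ^ min (J + 1) k) +
              ∑ i ∈ Finset.range (J + 1), ((F.P Kt).d * (((F.P Kt).L ^ i - 1) / 2) + 1) : ℕ) : ℤ) + 2) : Set (Plaq (F.P Kt) 0)) ⊆
        plaqsOf (Node00.suppDomOfRecord F ν Kt (maxDomT ν.M₁ Z)) := by
    intro b hbs hbt J J' hJ hJ' p hp
    -- the levels: `1 ≤ J ≤ k`, `J' ≤ J + 1`
    have hJk : J ≤ k := le_of_iterBlockOf_mem_Bj hJ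
    have hJ1 : 1 ≤ J := by
      by_contra h
      have hJ0 : J = 0 := by omega
      subst hJ0
      rw [B14.Eq213DetSet.Bj_zero (by omega)] at hJ
      exact hJ hbs
    obtain ⟨⟨-, hJ'le⟩, -⟩ := exists_chain_centre_centre_graded hM2 hdiv hk b hJ1 hJ hJ'
    have hxΩ : b.src ∈ maxDomT ν.M₁ Z J := mem_maxDomT_of_iterBlockOf_mem_Bj hM hdiv hk hJ1 hJ
    -- the radius is at most `R(J)`
    set R : ℕ := (2 * max (∑ i ∈ Finset.range (J + 1), ((F.P Kt).d * (((F.P Kt).L ^ i - 1) / 2) + 1))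
          (∑ i ∈ Finset.range (J' + 1), ((F.P Kt).d * (((F.P Kt).L ^ i - 1) / 2) + 1)) + 1 +
        (3 * ((F.P Kt).d * (((F.P Kt).L - 1) / 2)) + 5) * (F.P Kt).L ^ min (J + 1) k) +
      ∑ i ∈ Finset.range (J + 1), ((F.P Kt).d * (((F.P Kt).L ^ i - 1) / 2) + 1) with hRdef
    have hmax : max (∑ i ∈ Finset.range (J + 1), ((F.P Kt).d * (((F.P Kt).L ^ i - 1) / 2) + 1))
        (∑ i ∈ Finset.range (J' + 1), ((F.P Kt).d * (((F.P Kt).L ^ i - 1) / 2) + 1)) ≤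
        ∑ i ∈ Finset.range (J + 1 + 1), ((F.P Kt).d * (((F.P Kt).L ^ i - 1) / 2) + 1) :=
      max_le (hℓmono (Nat.le_succ J)) (hℓmono hJ'le)
    have hR : R + 3 ≤ (F.P Kt).L ^ (J - 1) * ν.M₁ := by
      have h := hRad J hJ1 hJk
      omega
    exact Or.inl (boxPlaqs_src_mem_hullD hM hdiv hJ1 hJk hxΩ hR hp)
  exact exists_gaugeLetterLoc_atRecord ν Kt hk0 hk hM2 hdiv Z hN hρn W 𝒞 hD hmin N hGN hN1 hεP hP hSΩ a θ hθ0 ha0 haN hθ ha hδ0 hWj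

end Record

end Summit.QuantumFields.YangMills.BalabanUVNodes.N12GaugeLetterLocOfClass

end
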